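/-
Origin: expansion seat `planner-pub-hodgecm-pv03-0`, handover v6 2026-08-18T04:12:44Z (`HOME/pub-hodgecm-pv03/lean/Pv03/PerL34/BallSpans.lean`, md5 1f1b8b8c, 274 lines);
landed by the gen-5 packager in gate run 21 as `HodgeCM/PerL34/BallSpans.lean` (import ^import Pv14\.PerL34\.P43FrameBall\b→import HodgeCM.PerL34.P43_frameBall ×1; import ^import Pv[0-9]+\.PerL34\.→import HodgeCM.PerL34. ×1).
-/
/-
Origin: HOME/pub-hodgecm-pv03/lean/Pv03/PerL34/BallSpans.lean — session planner-pub-hodgecm-pv03-0 (unit pub-hodgecm-pv03,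
DAG-NODE PROVER #03, node N33 holder).  Intended final place: `HodgeCM/PerL34/BallSpans.lean`, after
`HodgeCM/PerL34/BallGlue.lean` (pv03 v4, run 20), `HodgeCM/PerL34/BallCocycle.lean` (pv03 v5) and pv14's frame
dictionary `P43Frame.lean` / `P43FrameBall.lean` (handed over 04:04Z / 04:05Z; here `import Pv14.PerL34.P43FrameBall`
— PACKAGER: rewrite to the landed module name).  KERNEL: nothing cited, nothing asserted.
-/
import Summits.HodgeConjecture.HodgeCM.PerL34.BallGlue
import Summits.HodgeConjecture.HodgeCM.PerL34.BallCocycle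
import Summits.HodgeConjecture.HodgeCM.PerL34.P43_frameBall

/-!
# N33c on the ball from the GROUP-LEVEL spans (pv02) through the frame dictionary (pv14)

LEMMAS v3 §8 FRONTIER item (iv) — the `Δ`-stability ("Hecke-translate equivariance") of the spaces `𝒰₁, 𝒰₂` of theta
one-forms ON THE BALL, which `BallGlue.BallStepsInput` still carried as part of the INTERNAL input
`N33c_statement B.Δ A B.gen₁ B.gen₂` — is discharged here for the canonical ball model:

* the data are pv02's function-model data (`P43_lineSpan.lean`: theta functions `F` on `G_U(𝔸) = U(2,1) × G_c × G_f`,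
  `u_F = F(·,1,1)`, the slices `Θ_i(χ)[𝔭₊]`, the image `Γ` of `G_U(L₀)`), with the archimedean group and the fibre
  FIXED to the ball model's `U21` and `ℂ²` (`LineSpans`, `LineSpans.D : P43.LineSpanData`);
* the ball-level generators are DEFINED through pv14's frame reading `R` (`P43Frame.frameRead` for pv03's cotangent
  cocycle `A`, base point `x₀ = 0`): `gen i χ := R⁻¹ {u_F : F ∈ Θ_i(χ)[𝔭₊]}` (D2/D6 made definitional);
* then the three conjuncts of pv03's `WedgeNonvanishing.N33c_statement` for `(Δ, A, gen 0, gen 1)`, `Δ` = the image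
  of `Γ` in `U(2,1)`, FOLLOW from pv02's five INPUT Props (`LeftInvariant`, `CompactInvariant`, `FiniteStable` —
  automorphy / `K`-type / `G_U(𝔸_f)`-module, nodes N09–N10; `UHolomorphic` — N33b; `SomeNonzero` — N30 + N33a; the
  very hypotheses of pv02's kernel `LineSpanData.N33c_of`) and ONE definitional dictionary sentence `HolFromBall`
  ("the holomorphic `τ`-valued functions on `U(2,1)` of pv02's `Hol` are frame readings of continuous one-forms on
  `𝔹²`"): `Δ`-STABILITY by pv02's `uEval_lTransl` (`γ^* u_F = u_{R(γ_f⁻¹)F}`) + pv14's `stableUnder_comap` /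
  `stableUnder_iSup` + the cocycle identity `P43FrameBall.cocycle_A'`, whose hypothesis `ChainRule` is pv03's chain
  rule `BallModel.Jac_mul`; NON-VANISHING from pv02's `N33c_of` (third conjunct) + faithfulness of `R`
  (`P43Frame.frameRead_injective` from `A_injective`, `transitive`); CONTINUITY from `HolFromBall` + faithfulness.
* `BallSpanModel` / `BallSpanStepsInput T` / `open_thetaWedge_of_ballSpans`: the A6 input `Open_thetaWedge` over this
  model from `LevelDirected` (KERNEL), `N33eClosed` (pv01, KERNEL) and, per good context: pv02's five inputs,
  `HolFromBall`, `Dense Δ` (PRINT: real approximation), the allowed data (N31) and the three dictionary Props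
  `Dict_thetaClass₀/₁`, `Dict_cupWedge` of `WedgeToClasses` — NO ball-level stability / equivariance input remains.
-/

set_option autoImplicit false

noncomputable section

namespace HodgeCM
namespace PerL34
namespace BallSpans

open HodgeCM.PerL34.BallModel HodgeCM.PerL34.WedgeNonvanishing HodgeCM.PerL34.WedgeToClasses
  HodgeCM.PerL34.BallGlue HodgeCM.PerL34.P43

/-- pv14's hypothesis `P43FrameBall.ChainRule` IS pv03's chain rule `BallModel.Jac_mul`. -/
theorem chainRule : P43FrameBall.ChainRule := fun g h z => Jac_mul g h z

/-- The linear maps underlying the cotangent cocycle `A` (the form in which pv14's dictionary takes it). -/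
def Alin (g : U21) (z : Ball) : (Fin 2 → ℂ) →ₗ[ℂ] (Fin 2 → ℂ) :=
  ((A g z : (Fin 2 → ℂ) →L[ℂ] (Fin 2 → ℂ)) : (Fin 2 → ℂ) →ₗ[ℂ] (Fin 2 → ℂ))

/-- The cocycle identity of `A` (pv14 `cocycle_A'`, unconditional thanks to `Jac_mul`). -/
theorem cocycle (g h : U21) (z : Ball) (w : Fin 2 → ℂ) : A (g * h) z w = A g (h • z) (A h z w) :=
  P43FrameBall.cocycle_A' chainRule g h z w

/-- **The frame reading** `R u (g) = A g⁻¹ (g • x₀) (u (g • x₀))` of a `ℂ²`-valued one-form `u` on `𝔹²` as a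
`ℂ²`-valued function on `U(2,1)` (pv14's `P43Frame.frameRead` for the cotangent cocycle, base point `x₀ = 0`). -/
def R : (Ball → (Fin 2 → ℂ)) →ₗ[ℂ] (U21 → (Fin 2 → ℂ)) := P43Frame.frameRead Alin x₀

/-- (Ported verbatim from the HodgeCMPerL package; no docstring in the source.) -/
theorem R_apply (u : Ball → (Fin 2 → ℂ)) (g : U21) : R u g = A g⁻¹ (g • x₀) (u (g • x₀)) := rfl

/-- The dictionary is faithful (pv14 `frameRead_injective` + pv03 `A_injective`, `transitive`). -/
theorem R_injective : Function.Injective R :=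
  P43Frame.frameRead_injective Alin x₀ (fun g z => A_injective g z) (fun x => transitive x₀ x)

/-- **pv02's function-model DATA with the archimedean factor and the fibre fixed to the ball model**: the compact
factors `G_c`, the finite-adelic group `G_f`, the image `Γ` of `G_U(L₀)` in `U(2,1) × G_c × G_f`, the index types
`X i` of automorphic characters `χ'_i` of type `e(Ψ_i)` (FIXED lines), the slices `Θ_i(χ)[𝔭₊]` of `ℂ²`-valued theta
functions, and `Hol` (holomorphic one-forms on `𝔹²` read on the group). -/
structure LineSpans where
  /-- the compact factors `∏_{b ≠ ι₁} U(3)` -/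
  Gc : Type
  /-- `G_U(𝔸_f)` -/
  Gf : Type
  [iGc : Group Gc]
  [iGf : Group Gf]
  /-- the image of `G_U(L₀)` in `U(2,1) × G_c × G_f` -/
  Γ : Subgroup (U21 × Gc × Gf)
  /-- automorphic characters `χ'_i` of `[U(W_i)]` of archimedean type `e(Ψ_i)` -/
  X : Fin 2 → Type
  /-- `Θ_i(χ'_i)[𝔭₊]` as `ℂ²`-valued functions on `U(2,1) × G_c × G_f` -/
  ThetaP : (i : Fin 2) → X i → Submodule ℂ (U21 × Gc × Gf → (Fin 2 → ℂ))
  /-- holomorphic one-forms on `𝔹²` as `ℂ²`-valued functions on `U(2,1)` -/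
  Hol : Submodule ℂ (U21 → (Fin 2 → ℂ))

attribute [instance] LineSpans.iGc LineSpans.iGf

namespace LineSpans

variable (S : LineSpans)

/-- The same data as a `P43.LineSpanData` (pv02), so that pv02's input Props and theorems apply BY NAME. -/
abbrev D : P43.LineSpanData where
  Ginf := U21
  Gc := S.Gc
  Gf := S.Gf
  V := Fin 2 → ℂ
  Γ := S.Γ
  X := S.X
  ThetaP := S.ThetaP
  Hol := S.Hol

/-- The image `Δ` of `G_U(L₀)` in `U(2,1)` (projection of `Γ` to the archimedean factor at `ι₁`). -/
def Δ : Subgroup U21 := S.Γ.map (MonoidHom.fst U21 (S.Gc × S.Gf))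

/-- The group-level slice `{u_F : F ∈ Θ_i(χ)[𝔭₊]}` (pv02's `uEval`). -/
def slice (i : Fin 2) (χ : S.X i) : Submodule ℂ (U21 → (Fin 2 → ℂ)) :=
  (S.ThetaP i χ).map (uEval : (U21 × S.Gc × S.Gf → (Fin 2 → ℂ)) →ₗ[ℂ] (U21 → (Fin 2 → ℂ)))

/-- **D2/D6, DEFINITIONAL**: the theta one-forms ON THE BALL of the datum `χ` are the forms whose frame reading is a
`u_F`, `F ∈ Θ_i(χ)[𝔭₊]`: `gen i χ := R⁻¹ {u_F}`. -/
def gen (i : Fin 2) (χ : S.X i) : Submodule ℂ (Ball → (Fin 2 → ℂ)) := (S.slice i χ).comap R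

/-- **D2/D6, DEFINITIONAL dictionary sentence**: every element of `Hol` ("holomorphic one-forms on `𝔹²` as
`τ`-valued functions on `U(2,1)`") is the frame reading of a continuous `ℂ²`-valued one-form on `𝔹²`. -/
def HolFromBall : Prop := ∀ φ ∈ S.Hol, ∃ u : Ball → (Fin 2 → ℂ), Continuous u ∧ R u = φ

/-- (Ported verbatim from the HodgeCMPerL package; no docstring in the source.) -/
theorem slice_le_U (i : Fin 2) (χ : S.X i) : S.slice i χ ≤ S.D.U i := by
  intro φ hφ
  obtain ⟨F, hF, rfl⟩ := Submodule.mem_map.mp hφ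
  exact mem_USpan_of_mem uEval (S.D.ThetaP i) hF

/-- (Ported verbatim from the HodgeCMPerL package; no docstring in the source.) -/
theorem U_eq_iSup_slice (i : Fin 2) : S.D.U i = ⨆ χ, S.slice i χ := by
  rw [P43.LineSpanData.U_def, USpan_eq_iSup]
  rfl

/-- (Ported verbatim from the HodgeCMPerL package; no docstring in the source.) -/
theorem iSup_gen_le (i : Fin 2) : (⨆ χ, S.gen i χ) ≤ (S.D.U i).comap R :=
  iSup_le fun χ => Submodule.comap_mono (S.slice_le_U i χ)

/-- Each group-level slice is stable under `γ^*` (left translation by `γ_{ι₁}`), `γ ∈ G_U(L₀)`: pv02's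
`uEval_lTransl` (`γ^* u_F = u_{R(γ_f⁻¹) F}`) with `FiniteStable`. -/
theorem slice_stable (h1 : S.D.LeftInvariant) (h2 : S.D.CompactInvariant) (h3 : S.D.FiniteStable) (i : Fin 2)
    (χ : S.X i) : ∀ γ ∈ S.Δ, ∀ φ ∈ S.slice i χ, lTransl γ φ ∈ S.slice i χ := by
  intro γ₁ hγ₁ φ hφ
  obtain ⟨γ, hγ, rfl⟩ := Subgroup.mem_map.mp hγ₁
  obtain ⟨F, hF, rfl⟩ := Submodule.mem_map.mp hφ
  refine Submodule.mem_map.mpr ⟨rTransl γ.2.2⁻¹ F, h3 i χ γ.2.2⁻¹ F hF, ?_⟩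
  rw [MonoidHom.coe_fst]
  exact (uEval_lTransl F γ (h1 i χ F hF γ hγ) (h2 i χ F hF)).symm

/-- **`Δ`-stability of `𝒰_i = ⨆_χ gen i χ` on the ball** (the third conjunct of pv03's `N33c_statement`), KERNEL:
pv02 (`uEval_lTransl`) + pv14 (`stableUnder_comap`, `stableUnder_iSup`) + pv03 (`Jac_mul` via `cocycle`). -/
theorem stableUnder_gen (h1 : S.D.LeftInvariant) (h2 : S.D.CompactInvariant) (h3 : S.D.FiniteStable)
    (i : Fin 2) : StableUnder S.Δ A (⨆ χ, S.gen i χ) :=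
  P43Frame.stableUnder_iSup A S.Δ (S.gen i) fun χ =>
    P43Frame.stableUnder_comap A x₀ cocycle S.Δ (S.slice i χ) (S.slice_stable h1 h2 h3 i χ)

/-- Continuity of the ball-level theta one-forms: `R u ∈ 𝒰_i ≤ Hol` (pv02's `UHolomorphic`), `Hol` consists of
frame readings of continuous forms (`HolFromBall`), and `R` is injective. -/
theorem continuous_of_mem (h4 : S.D.UHolomorphic) (hH : S.HolFromBall) (i : Fin 2) {u : Ball → (Fin 2 → ℂ)}
    (hu : u ∈ ⨆ χ, S.gen i χ) : Continuous u := by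
  have hU : R u ∈ S.D.U i := S.iSup_gen_le i hu
  have hUle : S.D.U i ≤ S.D.Hol := by
    rw [P43.LineSpanData.U_def]
    exact USpan_le uEval (S.D.ThetaP i) (h4 i)
  obtain ⟨u', hu', he⟩ := hH (R u) (hUle hU)
  rw [← R_injective he]
  exact hu'

/-- Non-vanishing of `𝒰_i` on the ball: pv02's `N33c_of` gives `𝒰_i ≠ 0` on the group, hence a non-zero slice,
whose non-zero element is the frame reading of a (non-zero) ball form by `HolFromBall`. -/
theorem iSup_gen_ne_bot (h1 : S.D.LeftInvariant) (h2 : S.D.CompactInvariant) (h3 : S.D.FiniteStable)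
    (h4 : S.D.UHolomorphic) (h5 : S.D.SomeNonzero) (hH : S.HolFromBall) (i : Fin 2) :
    (⨆ χ, S.gen i χ) ≠ ⊥ := by
  obtain ⟨hUle, -, hUne⟩ := P43.LineSpanData.N33c_of S.D h1 h2 h3 h4 h5 i
  have hχ : ∃ χ : S.X i, S.slice i χ ≠ ⊥ := by
    by_contra hall
    apply hUne
    rw [S.U_eq_iSup_slice i, iSup_eq_bot]
    intro χ
    by_contra hne
    exact hall ⟨χ, hne⟩
  obtain ⟨χ, hχ⟩ := hχ
  obtain ⟨φ, hφ, hφ0⟩ := Submodule.exists_mem_ne_zero_of_ne_bot hχ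
  obtain ⟨u, -, hu⟩ := hH φ (hUle (S.slice_le_U i χ hφ))
  have hmem : u ∈ S.gen i χ := by
    change R u ∈ S.slice i χ
    rw [hu]
    exact hφ
  have hu0 : u ≠ 0 := by
    rintro rfl
    exact hφ0 (by rw [← hu, map_zero])
  intro hbot
  apply hu0
  have hu' : u ∈ ⨆ χ, S.gen i χ := Submodule.mem_iSup_of_mem χ hmem
  rw [hbot] at hu'
  exact (Submodule.mem_bot ℂ).mp hu'

/-- **N33c on the ball** (pv03's `WedgeNonvanishing.N33c_statement` for the canonical model with the dictionary
generators) from pv02's five inputs and the definitional sentence `HolFromBall`. -/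
theorem n33c_ball (h1 : S.D.LeftInvariant) (h2 : S.D.CompactInvariant) (h3 : S.D.FiniteStable)
    (h4 : S.D.UHolomorphic) (h5 : S.D.SomeNonzero) (hH : S.HolFromBall) :
    N33c_statement S.Δ A (S.gen 0) (S.gen 1) :=
  ⟨⟨S.iSup_gen_ne_bot h1 h2 h3 h4 h5 hH 0, fun _ hu => S.continuous_of_mem h4 hH 0 hu,
      S.stableUnder_gen h1 h2 h3 0⟩,
    ⟨S.iSup_gen_ne_bot h1 h2 h3 h4 h5 hH 1, fun _ hu => S.continuous_of_mem h4 hH 1 hu,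
      S.stableUnder_gen h1 h2 h3 1⟩⟩

end LineSpans

variable {L : CMField} {ι₁ : L →+* ℂ}

/-- **The ball model with dictionary generators**: pv02's function-model data over the ball model, the predicate
"allowed" on the data `(W_i, μ_i, χ'_i)`, the level and the class map of the forms dictionary. -/
structure BallSpanModel (U : Universe) (V : HermSpace3 L ι₁) extends LineSpans where
  /-- "`(W_i, μ_i, χ'_i)` is an allowed datum" (Def 3.2) -/
  allowed : (i : Fin 2) → X i → Prop
  /-- a torsion-free level of the form -/
  lvl : (Ball → (Fin 2 → ℂ)) → Level V
  /-- the de Rham class on `P_Γ` of a form descending to `Γ` -/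
  cls : (Γ : Level V) → (Ball → (Fin 2 → ℂ)) → U.CohC (U.pms L ι₁ V Γ) 1

variable {U : Universe} {V : HermSpace3 L ι₁}

namespace BallSpanModel

variable (M : BallSpanModel U V)

/-- The underlying `BallFormsModel` (pv03 `BallGlue`): generators `gen i χ = R⁻¹ {u_F : F ∈ Θ_i(χ)[𝔭₊]}`. -/
def toBallFormsModel : BallFormsModel U V where
  Δ := M.toLineSpans.Δ
  D₁ := M.X 0
  D₂ := M.X 1
  gen₁ := M.toLineSpans.gen 0
  gen₂ := M.toLineSpans.gen 1
  allowed₁ := M.allowed 0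
  allowed₂ := M.allowed 1
  lvl := M.lvl
  cls := M.cls

/-- pv02's five INPUT Props for the data of `M`. -/
def GroupInputs : Prop :=
  M.toLineSpans.D.LeftInvariant ∧ M.toLineSpans.D.CompactInvariant ∧ M.toLineSpans.D.FiniteStable ∧
    M.toLineSpans.D.UHolomorphic ∧ M.toLineSpans.D.SomeNonzero

/-- (Ported verbatim from the HodgeCMPerL package; no docstring in the source.) -/
theorem n33c (hG : M.GroupInputs) (hH : M.toLineSpans.HolFromBall) :
    N33c_statement M.toBallFormsModel.Δ A M.toBallFormsModel.gen₁ M.toBallFormsModel.gen₂ :=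
  M.toLineSpans.n33c_ball hG.1 hG.2.1 hG.2.2.1 hG.2.2.2.1 hG.2.2.2.2 hH

end BallSpanModel

variable (T : U.ThetaModel)

/-- **The residual input of node N33 over the ball model with dictionary generators**: per good context, the data
`M` with pv02's five group-level inputs (nodes N09–N10, N33b, N30 + N33a), the definitional sentence `HolFromBall`,
`Δ` dense (PRINT: real approximation), all data allowed (N31 = L4.2(b)), and the three dictionary Props. -/
def BallSpanStepsInput : Prop :=
  ∀ {L : CMField} {ι₁ : L →+* ℂ} (V : HermSpace3 L ι₁) (c : SeesawCtx L), T.GoodCtx ι₁ c →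
    ∃ M : BallSpanModel U V, M.GroupInputs ∧ M.toLineSpans.HolFromBall ∧
      Dense (M.toBallFormsModel.Δ : Set U21) ∧ (∀ i χ, M.allowed i χ) ∧
      M.toBallFormsModel.toFormsModelT.Dict_thetaClass₀ T c ∧ M.toBallFormsModel.toFormsModelT.Dict_thetaClass₁ T c ∧
      M.toBallFormsModel.toFormsModelT.toFormsModel.Dict_cupWedge

/-- (Ported verbatim from the HodgeCMPerL package; no docstring in the source.) -/
theorem ballStepsInput_of_spans (h : BallSpanStepsInput T) : BallStepsInput T := by
  intro L ι₁ V c hc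
  obtain ⟨M, hG, hH, hΔ, ha, h₀, h₁, hcup⟩ := h V c hc
  exact ⟨M.toBallFormsModel, M.n33c hG hH, hΔ, fun χ => ha 0 χ, fun χ => ha 1 χ, h₀, h₁, hcup⟩

/-- **A6 over the ball model with dictionary generators**: `Open_thetaWedge` from `LevelDirected` (KERNEL,
`HodgeCM.levelDirected`), `N33eClosed` (node N33e, KERNEL, pv01) and `BallSpanStepsInput T`. -/
theorem open_thetaWedge_of_ballSpans (hLD : LevelDirected) (hE : N33eClosed) (h : BallSpanStepsInput T) :
    T.Open_thetaWedge :=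
  open_thetaWedge_of_ballSteps T hLD hE (ballStepsInput_of_spans T h)

end BallSpans
end PerL34
end HodgeCM

end
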